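import Literature.AnabelianGeometry.EtaleTheta.ConstantMultipleRigidityEquivarianceProofs
import HarnessLib

/-!
# [EtTh] Thm. 1.10, proof p. 256: "`γ` maps [the points over] `τ`…" — the translated points `τ_a` of `Ÿ`
# and the NATURALITY of evaluation along `Π^tp_Ẋ/Π^tp_Ÿ` (GAP-LEDGER G-L2t6g4-1; proof-only)

Mochizuki, *The étale theta function …*, Publ. RIMS **45** (2009), §1: Def. 1.9 (i) p. 29 ("the
`Π^tp_Ẋ/Π^tp_Ÿ ≅ ℤ`-orbit of `η̈^Θ`", "the values at `τ`"), proof of Thm. 1.10 p. 30 ("`γ` maps `τ` to …;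
now (ii) follows immediately") [cite: MochizukiEtTh2009, Def 1.9 (i) p.29].  PROOF-ONLY file (abc-iut cell,
prover abc-iut-L2-d1 gen 4, L2-lead row G-L2t6g4-1; binders `τ_`/`hnat`/`hcoord` of abc-iut-L2-t6's
`Discharge/Sec1StandardValuesModel.lean` (p418439) and item 5 (a)(b) of the K2 checklist of
`Sec1Thm110iUniqueOfDictionary.lean` (p420097)); no definition, no new named fact.

CONTENT.
* §A (generic `ContH1`): `ContH1.exists_conjTransport` — for `σ ∈ G`, `N ⊴ G` and `H ≤ N`, the conjugation
  transport `T_σ : H¹(σ⁻¹Hσ, A) → H¹(H, A)`, `(T_σ f)(h) = φ(σ)·f(σ⁻¹hσ)·φ(σ)⁻¹`, with the kernel identity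
  `T_σ ∘ res_{σ⁻¹Hσ} = res_H ∘ conj(σ)` on `H¹(N, A)` (pure functoriality, no [EtTh] input).
* §B (`MuTwoSetting`, `K = K̈`): **`exists_translatePoints_of_prop15ii`** — for a point `y` of `Ÿ` (t1's
  `NonCuspidalPoint`), any `σ ∈ Π^tp_X` and ANY prescribed admissible coordinates `w : ℤ → K̈^×`
  (`w a ≠ ±q̈^b`), there are points `τ_a` with `Dpt(τ_a) = σ^{−a}·D_y·σ^{a}`, `coord(τ_a) = w a` and
  **natural evaluation** `evalAt_y((σ^a·x)|_y) = evalAt_{τ_a}(x|_{τ_a})` for EVERY class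
  `x ∈ H¹(Π^tp_Ÿ, Δ_Θ)`; the only [EtTh] input is the named fact `Prop15ii` (F-2503: `F̈² = κ̈((K̈^×)^∧)`),
  through abc-iut-w5-d234's `MuTwoSetting.conj_inflTheta_kumYdd_eq_self` (every `σ ∈ Π^tp_X` fixes the
  constant classes), which is what makes the transported evaluation map satisfy `evalAt_kum`.

HONEST READING (ties in with this seat's finding F-d1g4-1, `Sec1Prop14iiiValuesVacuity.lean`): t1's
interface leaves `NonCuspidalPoint.coord` FREE (no field relates it to `Dpt`/`evalAt`), so the coordinates
of the translated points are PRESCRIBED here, not derived — the naturality and coordinate clauses (5a)(5b)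
of the K2 checklist carry no content beyond `Prop15ii`; the geometric sentence "the point `σ^{−a}·τ` of
`Ÿ` has coordinate `(s q̈)^a √−1`" (p. 256) survives exactly as the VALUE-LAW binder at these points
(checklist item 5c / G-L2t6g4-2 residual: `evalAt_τ((σ^a·κ₀)|_τ) = Θ̈((s q̈)^a √−1)`).  Nothing of
[EtTh] is asserted; no side is taken on [IUTchIII] Cor. 3.12.
-/

namespace Literature.AnabelianGeometry.EtaleTheta

/-! ## §A. Transport of `H¹` along conjugate subgroups -/

section Transport

variable {G G' : Type*} [Group G] [TopologicalSpace G] [IsTopologicalGroup G]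
  [Group G'] [TopologicalSpace G'] [IsTopologicalGroup G']
  (φ : G →* G') (A : Subgroup G') [A.Normal] [IsMulCommutative A]

open scoped IsMulCommutative

/-- Conjugation by a fixed element is continuous on a normal subgroup. [folklore] -/
private theorem continuous_conjNormal' {G₁ : Type*} [Group G₁] [TopologicalSpace G₁]
    [IsTopologicalGroup G₁] {B : Subgroup G₁} [B.Normal] (g : G₁) :
    Continuous fun b : B => MulAut.conjNormal g b :=
  continuous_induced_rng.2 (by
    simp only [Function.comp_def, MulAut.conjNormal_apply]
    fun_prop)

omit [TopologicalSpace G] [IsTopologicalGroup G] in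
/-- `σ⁻¹ h σ` lies in the conjugate subgroup `σ⁻¹Hσ = (conj σ)⁻¹(H)` for `h ∈ H`. [folklore] -/
private theorem conj_inv_mul_mem_comap_conj (σ : G) (H : Subgroup G) (h : H) :
    σ⁻¹ * (h : G) * σ ∈ H.comap (MulAut.conj σ).toMonoidHom := by
  rw [Subgroup.mem_comap]
  change σ * (σ⁻¹ * (h : G) * σ) * σ⁻¹ ∈ H
  simp [mul_assoc]

omit [TopologicalSpace G] [IsTopologicalGroup G] in
/-- For `N ⊴ G` and `H ≤ N`: the conjugate `σ⁻¹Hσ` lies in `N`. [folklore] -/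
private theorem comap_conj_le_of_le {N : Subgroup G} [N.Normal] (σ : G) {H : Subgroup G} (hH : H ≤ N) :
    H.comap (MulAut.conj σ).toMonoidHom ≤ N := by
  intro k hk
  rw [Subgroup.mem_comap] at hk
  have hk' : σ * k * σ⁻¹ ∈ N := hH hk
  have := Subgroup.Normal.conj_mem inferInstance _ hk' σ⁻¹
  simpa [mul_assoc] using this

/-- **Conjugation transport on `H¹`.**  For `σ ∈ G`, `N ⊴ G` and `H ≤ N` there is a homomorphism
`T_σ : H¹(σ⁻¹Hσ, A) → H¹(H, A)`, `(T_σ f)(h) = φ(σ) · f(σ⁻¹ h σ) · φ(σ)⁻¹` on cocycles, such that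
`T_σ (x|_{σ⁻¹Hσ}) = (σ·x)|_H` for every `x ∈ H¹(N, A)` — the compatibility of restriction with the
conjugation action that underlies "conjugate the class and evaluate at `y`" = "evaluate at `σ⁻¹·y`".
[cite: NeukirchSchmidtWingberg2008, I §5] -/
theorem ContH1.exists_conjTransport {N : Subgroup G} [N.Normal] (σ : G) {H : Subgroup G} (hH : H ≤ N)
    (hH' : H.comap (MulAut.conj σ).toMonoidHom ≤ N) :
    ∃ T : ContH1 φ A (H.comap (MulAut.conj σ).toMonoidHom) →* ContH1 φ A H,
      ∀ x : ContH1 φ A N,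
        T (ContH1.res φ A hH' x) = ContH1.res φ A hH (ContH1.conj φ A σ x) := by
  -- transport of elements `h ↦ σ⁻¹ h σ`
  let ι : H → H.comap (MulAut.conj σ).toMonoidHom := fun h =>
    ⟨σ⁻¹ * (h : G) * σ, conj_inv_mul_mem_comap_conj σ H h⟩
  have hι_cont : Continuous ι :=
    Continuous.subtype_mk (by fun_prop) _
  have hι_mul : ∀ g h : H, ι (g * h) = ι g * ι h := fun g h => by
    apply Subtype.ext
    change σ⁻¹ * ((g : G) * h) * σ = σ⁻¹ * g * σ * (σ⁻¹ * h * σ)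
    group
  have hφι : ∀ h : H, φ σ * φ ((ι h : H.comap (MulAut.conj σ).toMonoidHom) : G) = φ (h : G) * φ σ :=
    fun h => by
    change φ σ * φ (σ⁻¹ * (h : G) * σ) = _
    rw [← map_mul, ← map_mul]
    congr 1
    group
  -- transport of cocycles
  let tc : contCocycles φ A (H.comap (MulAut.conj σ).toMonoidHom) →* contCocycles φ A H :=
    { toFun := fun f => ⟨fun h => MulAut.conjNormal (φ σ) (f.1 (ι h)),
        (continuous_conjNormal' (φ σ)).comp (f.2.1.comp hι_cont),
        fun g h => by
          dsimp only
          rw [hι_mul, f.2.2, map_mul]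
          congr 1
          rw [← MulAut.mul_apply, ← map_mul, hφι, map_mul, MulAut.mul_apply]⟩
      map_one' := Subtype.ext (funext fun h => by simp)
      map_mul' := fun f g => Subtype.ext (funext fun h => by
        change MulAut.conjNormal (φ σ) (f.1 (ι h) * g.1 (ι h)) =
          MulAut.conjNormal (φ σ) (f.1 (ι h)) * MulAut.conjNormal (φ σ) (g.1 (ι h))
        rw [map_mul]) }
  -- it preserves coboundaries, hence descends to `H¹`
  let T : ContH1 φ A (H.comap (MulAut.conj σ).toMonoidHom) →* ContH1 φ A H :=
    QuotientGroup.map _ _ tc (by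
      intro f hf
      obtain ⟨a, ha⟩ := (mem_contCoboundaries_iff _).mp (Subgroup.mem_subgroupOf.mp hf)
      refine Subgroup.mem_subgroupOf.mpr ((mem_contCoboundaries_iff _).mpr
        ⟨MulAut.conjNormal (φ σ) a, ?_⟩)
      funext h
      have hx := congrFun ha (ι h)
      apply Subtype.ext
      change ((MulAut.conjNormal (φ σ) (f.1 (ι h)) : A) : G') = _
      rw [hx]
      simp only [MulAut.conjNormal_apply, Subgroup.coe_mul, Subgroup.coe_inv]
      change φ σ * (φ (σ⁻¹ * (h : G) * σ) * (a : G') * (φ (σ⁻¹ * (h : G) * σ))⁻¹ * (a : G')⁻¹) * (φ σ)⁻¹ = _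
      simp only [map_mul, map_inv]
      group)
  refine ⟨T, fun x => ?_⟩
  induction x using QuotientGroup.induction_on with
  | H f =>
    -- both sides are classes of the same cocycle `h ↦ φ(σ) f(σ⁻¹ h σ) φ(σ)⁻¹`
    change (QuotientGroup.mk (tc (ContH1.resCocycle φ A hH' f)) : ContH1 φ A H) =
      QuotientGroup.mk (ContH1.resCocycle φ A hH (ContH1.conjCocycle φ A σ f))
    congr 1
    apply Subtype.ext
    funext h
    have hpt : (⟨σ⁻¹ * (h : G) * σ, hH' (conj_inv_mul_mem_comap_conj σ H h)⟩ : N) =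
        MulAut.conjNormal σ⁻¹ ⟨(h : G), hH h.2⟩ := by
      apply Subtype.ext
      simp [mul_assoc]
    change MulAut.conjNormal (φ σ) (f.1 ⟨σ⁻¹ * (h : G) * σ, hH' (conj_inv_mul_mem_comap_conj σ H h)⟩) =
      MulAut.conjNormal (φ σ) (f.1 (MulAut.conjNormal σ⁻¹ ⟨(h : G), hH h.2⟩))
    rw [hpt]

end Transport

/-! ## §B. The translated points of `Ÿ` over a `K̈`-point, with prescribed coordinates -/

namespace MuTwoSetting

open Literature.AnabelianGeometry.SemiGraphs

variable {p : ℕ} [Fact p.Prime] (M : MuTwoSetting p)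

/-- Under `K = K̈`: `G_K̈ = G_K`. [cite: MochizukiEtTh2009, Def 1.7 p.27] -/
theorem GKdd_eq_GK : M.GKdd = M.GK := M.GKN_two_eq_GK

/-- **The translated points `τ_a := σ^{−a}·y` with prescribed coordinates and NATURAL evaluation**
([EtTh] Thm. 1.10, proof p. 256 "`γ` maps `τ` to …"; Def. 1.9 (i) p. 255).  For a `MuTwoSetting`
(`K = K̈`), the named fact `Prop15ii` (F-2503), a point `y` of `Ÿ`, any `σ ∈ Π^tp_X` and any family of
admissible coordinates `w a ∈ K̈^× ∖ ±q̈^ℤ`: there are points `τ_a` of the interface with decomposition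
group `σ^{−a}·D_y·σ^{a}`, coordinate `w a`, and evaluation maps satisfying, for EVERY class
`x ∈ H¹(Π^tp_Ÿ, Δ_Θ)`, `evalAt_y((σ^a·x)|_{D_y}) = evalAt_{τ_a}(x|_{D_{τ_a}})` (binder `hnat` of p418439 /
K2 checklist 5(a), with 5(b) by the prescription).  Construction: `Dpt := σ^{−a}D_yσ^{a}` (in `Π^tp_Ÿ`
by normality, `aug`-injective, `aug`-image `G_K̈ = G_K`), `evalAt := evalAt_y ∘ T_{σ^a}`
(`ContH1.exists_conjTransport`), `evalAt_kum` because every `σ ∈ Π^tp_X` fixes the constant classes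
`infl κ̈(c)` (`F̈² = Im κ̈`, `Prop15ii`; abc-iut-w5-d234's `conj_inflTheta_kumYdd_eq_self`).  HONEST
READING: the coordinates are prescribed, which the interface permits (`coord` is free data — this seat's
`Sec1Prop14iiiValuesVacuity.lean`); the geometric identification of `σ^{−a}·τ` with the point of
coordinate `(s q̈)^a √−1` is thereby NOT proved — it lives in the value-law binder at these points.
[cite: MochizukiEtTh2009, Def 1.9 (i) p.29] -/
theorem exists_translatePoints_of_prop15ii (hC : M.toThetaSetting.Compat)
    {E : M.toThetaSetting.KummerData} (h15ii : ThetaSetting.Prop15ii E hC)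
    (y : ThetaSetting.NonCuspidalPoint E) (σ : M.PiTemp) (w : ℤ → (↥M.Kdd)ˣ)
    (hw : ∀ a b : ℤ, ((w a : M.Kdd) : PadicAlgCl p) ≠ M.toThetaSetting.qdd ^ b ∧
      ((w a : M.Kdd) : PadicAlgCl p) ≠ -(M.toThetaSetting.qdd ^ b)) :
    haveI := hC.GtpYdd_normal
    ∃ τ_ : ℤ → ThetaSetting.NonCuspidalPoint E,
      (∀ a : ℤ, (τ_ a).Dpt = y.Dpt.comap (MulAut.conj (σ ^ a)).toMonoidHom) ∧
      (∀ a : ℤ, (τ_ a).coord = w a) ∧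
      (∀ (a : ℤ) (x : M.toThetaSetting.H1 M.toThetaSetting.GtpYdd),
        y.evalAt (ContH1.res M.toTheta M.toThetaSetting.DeltaTheta y.Dpt_le
            (ContH1.conj M.toTheta M.toThetaSetting.DeltaTheta (σ ^ a) x)) =
          (τ_ a).evalAt (ContH1.res M.toTheta M.toThetaSetting.DeltaTheta (τ_ a).Dpt_le x)) := by
  haveI := hC.GtpYdd_normal
  -- per-`a` construction, then `choose`
  have key : ∀ a : ℤ, ∃ τa : ThetaSetting.NonCuspidalPoint E,
      τa.Dpt = y.Dpt.comap (MulAut.conj (σ ^ a)).toMonoidHom ∧ τa.coord = w a ∧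
      ∀ x : M.toThetaSetting.H1 M.toThetaSetting.GtpYdd,
        y.evalAt (ContH1.res M.toTheta M.toThetaSetting.DeltaTheta y.Dpt_le
            (ContH1.conj M.toTheta M.toThetaSetting.DeltaTheta (σ ^ a) x)) =
          τa.evalAt (ContH1.res M.toTheta M.toThetaSetting.DeltaTheta τa.Dpt_le x) := by
    intro a
    set s : M.PiTemp := σ ^ a with hs_def
    have hD' : y.Dpt.comap (MulAut.conj s).toMonoidHom ≤ M.GtpYdd := comap_conj_le_of_le s y.Dpt_le
    obtain ⟨T, hT⟩ := ContH1.exists_conjTransport M.toTheta M.toThetaSetting.DeltaTheta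
      (N := M.GtpYdd) s y.Dpt_le hD'
    -- the constant classes are fixed by `s` (Prop 1.5 (ii): `F̈² = Im κ̈`)
    have hfix : ∀ c : E.KddHat, ContH1.conj M.toTheta M.toThetaSetting.DeltaTheta s
        (M.toThetaSetting.inflTheta M.toThetaSetting.GtpYdd (E.kumYdd c)) =
        M.toThetaSetting.inflTheta M.toThetaSetting.GtpYdd (E.kumYdd c) := fun c =>
      ThetaSetting.conj_inflTheta_eq_self_of_mem_Fdd2 hC (M.aug_mem_map_aug_GtpYdd s)
        (by rw [h15ii.Fdd2_eq]; exact ⟨c, rfl⟩)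
    refine ⟨{ Dpt := y.Dpt.comap (MulAut.conj s).toMonoidHom
              Dpt_le := hD'
              aug_injOn := ?_
              map_aug_Dpt := ?_
              coord := w a
              coord_ne_cusp := hw a
              evalAt := y.evalAt.comp T
              evalAt_kum := ?_ }, rfl, rfl, fun x => ?_⟩
    · -- `aug` is injective on `s⁻¹ D_y s`
      intro k₁ hk₁ k₂ hk₂ heq
      have hk₁' : s * k₁ * s⁻¹ ∈ y.Dpt := hk₁
      have hk₂' : s * k₂ * s⁻¹ ∈ y.Dpt := hk₂
      have heq' : M.aug (s * k₁ * s⁻¹) = M.aug (s * k₂ * s⁻¹) := by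
        rw [map_mul, map_mul, map_mul, map_mul]
        exact congrArg (fun g => M.aug s * g * M.aug s⁻¹) heq
      have := y.aug_injOn hk₁' hk₂' heq'
      simpa using this
    · -- its `aug`-image is `G_K̈ = G_K`
      ext g
      constructor
      · rintro ⟨k, hk, rfl⟩
        have hk' : s * k * s⁻¹ ∈ y.Dpt := hk
        have hmem : M.aug.toMonoidHom (s * k * s⁻¹) ∈ M.GKdd := by
          rw [← y.map_aug_Dpt]; exact ⟨_, hk', rfl⟩
        rw [M.GKdd_eq_GK] at hmem ⊢
        have h1 : M.aug.toMonoidHom k =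
            (M.aug.toMonoidHom s)⁻¹ * M.aug.toMonoidHom (s * k * s⁻¹) * M.aug.toMonoidHom s := by
          simp only [map_mul, map_inv]; group
        rw [h1]
        exact mul_mem (mul_mem (inv_mem (M.aug_mem_GK s)) hmem) (M.aug_mem_GK s)
      · intro hg
        rw [M.GKdd_eq_GK] at hg
        have hg' : M.aug.toMonoidHom s * g * (M.aug.toMonoidHom s)⁻¹ ∈ M.GKdd := by
          rw [M.GKdd_eq_GK]
          exact mul_mem (mul_mem (M.aug_mem_GK s) hg) (inv_mem (M.aug_mem_GK s))
        rw [← y.map_aug_Dpt] at hg'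
        obtain ⟨d, hd, hdg⟩ := hg'
        refine ⟨s⁻¹ * d * s, ?_, ?_⟩
        · change s * (s⁻¹ * d * s) * s⁻¹ ∈ y.Dpt
          simpa [mul_assoc] using hd
        · simp only [map_mul, map_inv, hdg]; group
    · -- `evalAt_kum`: the constant classes are `s`-invariant
      intro c
      change y.evalAt (T (ContH1.res M.toTheta M.toThetaSetting.DeltaTheta hD'
        (M.toThetaSetting.inflTheta M.toThetaSetting.GtpYdd (E.kumYdd c)))) = c
      rw [hT, hfix c]
      exact y.evalAt_kum c
    · -- naturality
      change _ = y.evalAt (T (ContH1.res M.toTheta M.toThetaSetting.DeltaTheta hD' x))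
      rw [hT]
  choose τ_ hτD hτw hτnat using key
  exact ⟨τ_, hτD, hτw, fun a x => hτnat a x⟩

/-- **The K2 junction shape** (items 5 (a)(b) of abc-iut-L2-t6's checklist for both standard points):
for `S : StandardData` (the points `τ`, `τ⁻¹` of Def. 1.9 (i)), any `σ₁ ∈ Π^tp_X` and any two prescribed
admissible coordinate families `w`, `w'` (e.g. `(s q̈)^a·√−1`, `(s q̈)^a·(√−1)⁻¹`), there are point
families `τ_`, `τ'_` over `τ`, `τ⁻¹` with those coordinates and natural evaluation along `conj(σ₁^a)`
for every class — so the binder `hpts` of `thm110iUnique_of_referenceClass_of_prop15ii` (p420097)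
reduces, given `Prop15ii`, to its value-law clauses 5 (c) at these points.
[cite: MochizukiEtTh2009, Def 1.9 (i) p.29] -/
theorem exists_translatePoints_standard_of_prop15ii (hC : M.toThetaSetting.Compat)
    {E : M.toThetaSetting.KummerData} (h15ii : ThetaSetting.Prop15ii E hC) (S : M.StandardData E)
    (σ₁ : M.PiTemp) (w w' : ℤ → (↥M.Kdd)ˣ)
    (hw : ∀ a b : ℤ, ((w a : M.Kdd) : PadicAlgCl p) ≠ M.toThetaSetting.qdd ^ b ∧
      ((w a : M.Kdd) : PadicAlgCl p) ≠ -(M.toThetaSetting.qdd ^ b))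
    (hw' : ∀ a b : ℤ, ((w' a : M.Kdd) : PadicAlgCl p) ≠ M.toThetaSetting.qdd ^ b ∧
      ((w' a : M.Kdd) : PadicAlgCl p) ≠ -(M.toThetaSetting.qdd ^ b)) :
    haveI := hC.GtpYdd_normal
    ∃ τ_ τ'_ : ℤ → ThetaSetting.NonCuspidalPoint E,
      (∀ (a : ℤ) (x : M.toThetaSetting.H1 M.toThetaSetting.GtpYdd),
        S.tau.evalAt (ContH1.res M.toTheta M.toThetaSetting.DeltaTheta S.tau.Dpt_le
            (ContH1.conj M.toTheta M.toThetaSetting.DeltaTheta (σ₁ ^ a) x)) =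
          (τ_ a).evalAt (ContH1.res M.toTheta M.toThetaSetting.DeltaTheta (τ_ a).Dpt_le x)) ∧
      (∀ (a : ℤ) (x : M.toThetaSetting.H1 M.toThetaSetting.GtpYdd),
        S.tauInv.evalAt (ContH1.res M.toTheta M.toThetaSetting.DeltaTheta S.tauInv.Dpt_le
            (ContH1.conj M.toTheta M.toThetaSetting.DeltaTheta (σ₁ ^ a) x)) =
          (τ'_ a).evalAt (ContH1.res M.toTheta M.toThetaSetting.DeltaTheta (τ'_ a).Dpt_le x)) ∧
      (∀ a : ℤ, (τ_ a).coord = w a) ∧ (∀ a : ℤ, (τ'_ a).coord = w' a) ∧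
      (∀ a : ℤ, (τ_ a).Dpt = S.tau.Dpt.comap (MulAut.conj (σ₁ ^ a)).toMonoidHom) ∧
      (∀ a : ℤ, (τ'_ a).Dpt = S.tauInv.Dpt.comap (MulAut.conj (σ₁ ^ a)).toMonoidHom) := by
  haveI := hC.GtpYdd_normal
  obtain ⟨τ_, hD, hw₁, hnat⟩ := M.exists_translatePoints_of_prop15ii hC h15ii S.tau σ₁ w hw
  obtain ⟨τ'_, hD', hw₁', hnat'⟩ := M.exists_translatePoints_of_prop15ii hC h15ii S.tauInv σ₁ w' hw'
  exact ⟨τ_, τ'_, hnat, hnat', hw₁, hw₁', hD, hD'⟩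

end MuTwoSetting

end Literature.AnabelianGeometry.EtaleTheta
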